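/- LEAD seat `ym-line-cbag-p1` (prover-ym-line-cbag-p1-g24-0), route `EguchiKawaiDirectionLadder` (ideator ym-idea-2, LINE 8),
crux K_A `TripleSmallBallMargin` (stmt-QuantumFields-27724), architecture note ARCH-27724-lead-g24 §2 (S5): the repaired
within-cluster stub (a′) — the UNCONDITIONAL `N`-uniform Bhanot–Heller–Neuberger small-ball bound for Haar triples,
`ekHaar 3 N {S_R ≤ t} ≤ exp(N²((3/4 − η) log t + C))` for `0 < t ≤ 1` — DERIVED from entrywise rigidity (hypothesis
`EntrywiseRigidity`, w3's engine) alone, via the pair small-ball bound and Weyl's integral formula (PROVED in the tree): ONE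
conditioning on the first link, the trivial `P(· | U₀) ≤ min{a(U₀)², Ψ}` and `min{A,B} ≤ √(AB)` under the Weyl sup bound.  No
Austing–Wheater induction, no decoupling, no rank-robustness.  ROUTE-INDEPENDENT (no Theses import; the literal body of w5's
`FreeTripleSmallBallLe1` is the conclusion).  Nothing here bears on the Yang–Mills mass gap (barrier-ledger line). -/
import Summits.QuantumFields.YangMills.Theorems.EguchiKawaiDirectionLadderPairSmallBall
import Summits.QuantumFields.YangMills.Theorems.EguchiKawaiDirectionLadderFirstLinkFibre
import HarnessLib

/-!
# Route `EguchiKawaiDirectionLadder`, crux `TripleSmallBallMargin`: the free triple bound (a′) from entrywise rigidity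

`freeTripleLe1_of_entrywiseRigidity : EntrywiseRigidity → (∀ η > 0, ∃ C ≥ 0, ∃ N₀, ∀ N ≥ N₀, ∀ 0 < t ≤ 1,
  ekHaar 3 N {S_R ≤ t} ≤ exp(N²((3/4 − η) log t + C)))`.

PROOF.  `S_R(U₀,U₁,U₂) = S_R(U₀,U₁) + S_R(U₀,U₂) + S_R(U₁,U₂)` (pair actions, `ekAction_cons_two`), so the first-link fibre of
`{S_R ≤ t}` over `U₀` lies in `A(U₀) × A(U₀)` (`A(U₀) = {W : S_R(U₀,W) ≤ t}`) and in `{S_R(U₁,U₂) ≤ t}`; hence its `ekHaar 2 N`-measure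
`F(U₀)` is `≤ min{Haar(A(U₀))², Ψ}` with `Ψ = ekHaar 2 N{S_R ≤ t} ≤ exp(N²(C₂ − η′ log t)) t^{P}` (`pairSmallBall_of_entrywiseRigidity`,
`P = C(N,2)`).  `F` is a measurable class function (w4's `firstFibre_conj`), and on `U₀ = diag(d)` entrywise rigidity gives
`Haar(A) ≤ exp(N²(C₁ − η′ log t)) ∏_{j<k} pairFactor (κt) |d_j − d_k|² =: a`; `min{a², Ψ} ≤ a √Ψ`; the Weyl sup bound
(`lintegral_haar_le_of_classFunction` + `weylWeight_mul_le_of_pairwise`, `|d_j − d_k|²·pairFactor ≤ κt`) gives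
`ekHaar 3 N {S_R ≤ t} ≤ exp(N²(C₁ − η′ log t)) √Ψ (κt)^{P}`, whose logarithm is `(3/2)P log t + O_η′(N²)|log t| + O(N²)`, i.e.
exponent `(3/4)N(N−1) ≥ (3/4 − η)N²` in `log t ≤ 0` once `N ≥ 6/(5η)` (`η′ = η/4`).
-/

set_option autoImplicit false

noncomputable section

open MeasureTheory
open scoped ENNReal
open Literature.Barriers.QuantumFields

namespace Summit.QuantumFields.YangMills.Theorems.EguchiKawaiDirectionLadder

open Literature.MathematicalPhysics.QuantumFieldTheory (haarProbability)
open Literature.LinearAlgebra.Matrix (diagonalTorus)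
open Literature.RepresentationTheory.CompactGroups.WeylIntegration (weylWeight)

variable {N : ℕ}

/-! ### The three-link action splits into three pair actions -/

/-- Links of `Fin.cons U₀ W`. -/
theorem cons_apply_one (U₀ : UN N) (W : EKConfig 2 N) : (Fin.cons U₀ W : EKConfig 3 N) 1 = W 0 := rfl

/-- Links of `Fin.cons U₀ W`. -/
theorem cons_apply_two (U₀ : UN N) (W : EKConfig 2 N) : (Fin.cons U₀ W : EKConfig 3 N) 2 = W 1 := rfl

/-- **Action splitting for three links**: `S_R(U₀, U₁, U₂) = S_R(U₀, U₁) + S_R(U₀, U₂) + S_R(U₁, U₂)`. -/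
theorem ekAction_three_eq (U : EKConfig 3 N) :
    ekAction U = ekAction ((![U 0, U 1] : EKConfig 2 N)) + ekAction ((![U 0, U 2] : EKConfig 2 N)) + ekAction ((![U 1, U 2] : EKConfig 2 N)) := by
  simp only [ekAction, ekPlaqTrace, Fin.sum_univ_three, Fin.sum_univ_two, Matrix.cons_val_zero, Matrix.cons_val_one]
  norm_num [Fin.ext_iff]
  ring

/-- **Action splitting**: `S_R(U₀, W₀, W₁) = S_R(U₀, W₀) + S_R(U₀, W₁) + S_R(W₀, W₁)`. -/
theorem ekAction_cons_two (U₀ : UN N) (W : EKConfig 2 N) :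
    ekAction (Fin.cons U₀ W : EKConfig 3 N) =
      ekAction ((![U₀, W 0] : EKConfig 2 N)) + ekAction ((![U₀, W 1] : EKConfig 2 N)) + ekAction W := by
  rw [ekAction_three_eq, Fin.cons_zero, cons_apply_one, cons_apply_two, vecCons_eta_two]

/-- The first-link fibre of `{S_R ≤ t}` lies in the product `A(U₀) × A(U₀)`, `A(U₀) = {W : S_R(U₀, W) ≤ t}`. -/
theorem fibre_subset_pi (U₀ : UN N) (t : ℝ) :
    {W : EKConfig 2 N | (Fin.cons U₀ W : EKConfig 3 N) ∈ {U : EKConfig 3 N | ekAction U ≤ t}} ⊆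
      Set.pi Set.univ (fun _ : Fin 2 => {W' : UN N | ekAction ((![U₀, W'] : EKConfig 2 N)) ≤ t}) := by
  intro W hW
  simp only [Set.mem_setOf_eq, ekAction_cons_two] at hW
  have h0 := ekAction_nonneg ((![U₀, W 0] : EKConfig 2 N))
  have h1 := ekAction_nonneg ((![U₀, W 1] : EKConfig 2 N))
  have h2 := ekAction_nonneg W
  simp only [Set.mem_pi, Set.mem_univ, forall_true_left, Set.mem_setOf_eq, Fin.forall_fin_two]
  constructor <;> linarith

/-- The first-link fibre of `{S_R ≤ t}` lies in the two-link event `{S_R(W₀, W₁) ≤ t}`. -/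
theorem fibre_subset_pair (U₀ : UN N) (t : ℝ) :
    {W : EKConfig 2 N | (Fin.cons U₀ W : EKConfig 3 N) ∈ {U : EKConfig 3 N | ekAction U ≤ t}} ⊆
      {W : EKConfig 2 N | ekAction W ≤ t} := by
  intro W hW
  simp only [Set.mem_setOf_eq, ekAction_cons_two] at hW ⊢
  have h0 := ekAction_nonneg ((![U₀, W 0] : EKConfig 2 N))
  have h1 := ekAction_nonneg ((![U₀, W 1] : EKConfig 2 N))
  linarith

/-- **The fibre bound** `F(U₀) ≤ min{Haar(A(U₀))², ekHaar 2 N{S_R ≤ t}}`. -/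
theorem fibre_le_min (U₀ : UN N) (t : ℝ) :
    ekHaar 2 N {W : EKConfig 2 N | (Fin.cons U₀ W : EKConfig 3 N) ∈ {U : EKConfig 3 N | ekAction U ≤ t}} ≤
      min (haarProbability (UN N) {W' : UN N | ekAction ((![U₀, W'] : EKConfig 2 N)) ≤ t} ^ 2)
        (ekHaar 2 N {W : EKConfig 2 N | ekAction W ≤ t}) := by
  refine le_min ?_ (measure_mono (fibre_subset_pair U₀ t))
  refine (measure_mono (fibre_subset_pi U₀ t)).trans ?_
  unfold ekHaar
  rw [Measure.pi_pi, Finset.prod_const, Finset.card_univ, Fintype.card_fin]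

/-! ### Measurability and conjugation invariance of the fibre function -/

/-- The triple event `{S_R ≤ t}` is closed, hence measurable. -/
theorem measurableSet_actionLe (d N : ℕ) (t : ℝ) : MeasurableSet {U : EKConfig d N | ekAction U ≤ t} :=
  (isClosed_ekAction_le t).measurableSet

/-- The map `(U₀, W) ↦ Fin.cons U₀ W : U(N) × U(N)² → U(N)³` is measurable. -/
theorem measurable_cons_prod :
    Measurable fun q : UN N × EKConfig 2 N => (Fin.cons q.1 q.2 : EKConfig 3 N) := by
  refine measurable_pi_iff.mpr fun i => ?_
  refine Fin.cases ?_ (fun j => ?_) i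
  · simpa using measurable_fst
  · simp only [Fin.cons_succ]
    exact (measurable_pi_apply j).comp measurable_snd

/-- The fibre function `U₀ ↦ ekHaar 2 N {W : S_R(U₀, W) ≤ t}` is measurable. -/
theorem measurable_fibre (t : ℝ) :
    Measurable fun U₀ : UN N =>
      ekHaar 2 N {W : EKConfig 2 N | (Fin.cons U₀ W : EKConfig 3 N) ∈ {U : EKConfig 3 N | ekAction U ≤ t}} := by
  have hs : MeasurableSet {q : UN N × EKConfig 2 N | (Fin.cons q.1 q.2 : EKConfig 3 N) ∈ {U : EKConfig 3 N | ekAction U ≤ t}} :=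
    measurable_cons_prod (measurableSet_actionLe 3 N t)
  exact measurable_measure_prodMk_left hs

/-- The fibre function is a class function of the first link. -/
theorem fibre_conj (t : ℝ) (g u : UN N) :
    ekHaar 2 N {W : EKConfig 2 N | (Fin.cons (g * u * g⁻¹) W : EKConfig 3 N) ∈ {U : EKConfig 3 N | ekAction U ≤ t}} =
      ekHaar 2 N {W : EKConfig 2 N | (Fin.cons u W : EKConfig 3 N) ∈ {U : EKConfig 3 N | ekAction U ≤ t}} :=
  firstFibre_conj (measurableSet_actionLe 3 N t) (fun V U hU => by
    simp only [Set.mem_setOf_eq] at hU ⊢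
    rwa [ekAction_conj]) g u

/-! ### Elementary real-analysis bookkeeping -/

/-- `min(a², ψ) ≤ a · √ψ` for `a, ψ ≥ 0`. -/
theorem min_sq_le_mul_sqrt {a ψ : ℝ} (ha : 0 ≤ a) (hψ : 0 ≤ ψ) : min (a ^ 2) ψ ≤ a * Real.sqrt ψ := by
  by_cases h : a ≤ Real.sqrt ψ
  · calc min (a ^ 2) ψ ≤ a ^ 2 := min_le_left _ _
      _ = a * a := sq a
      _ ≤ a * Real.sqrt ψ := mul_le_mul_of_nonneg_left h ha
  · have h' : Real.sqrt ψ ≤ a := (not_le.1 h).le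
    calc min (a ^ 2) ψ ≤ ψ := min_le_right _ _
      _ = Real.sqrt ψ * Real.sqrt ψ := (Real.mul_self_sqrt hψ).symm
      _ ≤ a * Real.sqrt ψ := mul_le_mul_of_nonneg_right h' (Real.sqrt_nonneg _)

/-- `min` of two `ofReal` bounds. -/
theorem min_le_ofReal_min {x : ℝ≥0∞} {a b : ℝ} (ha : x ≤ ENNReal.ofReal a) (hb : x ≤ ENNReal.ofReal b) :
    x ≤ ENNReal.ofReal (min a b) := by
  rcases le_total a b with h | h
  · rw [min_eq_left h]; exact ha
  · rw [min_eq_right h]; exact hb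

/-- `2 · C(N,2) = N² − N` in `ℝ`. -/
theorem two_mul_choose_two (N : ℕ) : (2 : ℝ) * ((N.choose 2 : ℕ) : ℝ) = (N : ℝ) ^ 2 - N := by
  rw [Nat.cast_choose_two]; ring

/-- **The exponent bookkeeping**: with `η′ = η/4`, `P = C(N,2)`, `N ≥ 6/(5η)`, `log t ≤ 0`, `κ ≥ 1`:
`N²(C₁ − η′L) + (N²(C₂ − η′L) + P·L)/2 + P(log κ + L) ≤ N²((3/4 − η)L + (C₁ + C₂/2 + log κ))`. -/
theorem exponent_bookkeeping {η C₁ C₂ κ L : ℝ} {N : ℕ} (hη : 0 < η) (hκ : 1 ≤ κ) (hL : L ≤ 0)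
    (hN : 6 / (5 * η) ≤ N) :
    (N : ℝ) ^ 2 * (C₁ - η / 4 * L) + ((N : ℝ) ^ 2 * (C₂ - η / 4 * L) + ((N.choose 2 : ℕ) : ℝ) * L) / 2 +
        ((N.choose 2 : ℕ) : ℝ) * (Real.log κ + L) ≤
      (N : ℝ) ^ 2 * ((3 / 4 - η) * L + (C₁ + C₂ / 2 + Real.log κ)) := by
  set P : ℝ := ((N.choose 2 : ℕ) : ℝ) with hPdef
  have hP : 2 * P = (N : ℝ) ^ 2 - N := two_mul_choose_two N
  have hlogκ : 0 ≤ Real.log κ := Real.log_nonneg hκ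
  have hNnn : (0 : ℝ) ≤ N := Nat.cast_nonneg N
  have hPle : P ≤ (N : ℝ) ^ 2 := by nlinarith
  -- the bracket `(5η/8)N² − (3/4)N ≥ 0` from `N ≥ 6/(5η)`
  have hbr : 0 ≤ 5 * η / 8 * (N : ℝ) ^ 2 - 3 / 4 * N := by
    have h1 : 6 ≤ 5 * η * N := by
      have := (div_le_iff₀ (by positivity : (0 : ℝ) < 5 * η)).1 hN
      linarith
    nlinarith
  -- difference LHS − RHS = L·bracket + log κ·(P − N²) ≤ 0
  nlinarith [mul_nonneg_of_nonpos_of_nonpos hL (by linarith : -(5 * η / 8 * (N : ℝ) ^ 2 - 3 / 4 * N) ≤ 0),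
    mul_nonneg hlogκ (by linarith : 0 ≤ (N : ℝ) ^ 2 - P)]

/-! ### The free triple bound -/

/-- **S5 (a′): entrywise rigidity ⇒ the free triple small-ball bound with the Bhanot–Heller–Neuberger exponent `3/4 − η`**,
`N`-uniform, for `0 < t ≤ 1` (the literal body of `FreeTripleSmallBallLe1` of skeleton v6 of stmt-QuantumFields-27724). -/
theorem freeTripleLe1_of_entrywiseRigidity (hE : EntrywiseRigidity) :
    ∀ η : ℝ, 0 < η → ∃ C : ℝ, 0 ≤ C ∧ ∃ N₀ : ℕ, ∀ N : ℕ, N₀ ≤ N → ∀ t : ℝ, 0 < t → t ≤ 1 →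
      ekHaar 3 N {U : EKConfig 3 N | ekAction U ≤ t} ≤
        ENNReal.ofReal (Real.exp ((N : ℝ) ^ 2 * ((3 / 4 - η) * Real.log t + C))) := by
  intro η hη
  have hη4 : 0 < η / 4 := by positivity
  obtain ⟨κ, hκ, C₁, hC₁, N₁, h₁⟩ := hE (η / 4) hη4
  obtain ⟨C₂, hC₂, N₂, h₂⟩ := pairSmallBall_of_entrywiseRigidity hE (η / 4) hη4
  refine ⟨C₁ + C₂ / 2 + Real.log κ, by positivity [Real.log_nonneg hκ], max (max N₁ N₂) (⌈6 / (5 * η)⌉₊),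
    fun N hN t ht ht1 => ?_⟩
  have hN₁ : N₁ ≤ N := le_trans (le_max_left _ _) ((le_max_left _ _).trans hN)
  have hN₂ : N₂ ≤ N := le_trans (le_max_right _ _) ((le_max_left _ _).trans hN)
  have hN₃ : (6 / (5 * η) : ℝ) ≤ N := (Nat.le_ceil _).trans (by exact_mod_cast (le_max_right _ _).trans hN)
  have hκt : 0 ≤ κ * t := mul_nonneg (zero_le_one.trans hκ) ht.le
  set L := Real.log t with hL
  have hL0 : L ≤ 0 := Real.log_nonpos ht.le ht1
  set P : ℕ := N.choose 2 with hPdef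
  -- the two ingredient bounds
  set ψ : ℝ := Real.exp ((N : ℝ) ^ 2 * (C₂ - η / 4 * L)) * t ^ P with hψ
  have hψ0 : 0 ≤ ψ := mul_nonneg (Real.exp_pos _).le (pow_nonneg ht.le _)
  have hΨ : ekHaar 2 N {W : EKConfig 2 N | ekAction W ≤ t} ≤ ENNReal.ofReal ψ := h₂ N hN₂ t ht ht1
  -- Fubini over the first link + Weyl sup bound
  rw [ekHaar_succ_eq_lintegral_firstFibre (measurableSet_actionLe 3 N t)]
  have hmain : ∫⁻ U₀, ekHaar 2 N {W : EKConfig 2 N | (Fin.cons U₀ W : EKConfig 3 N) ∈ {U : EKConfig 3 N | ekAction U ≤ t}}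
        ∂haarProbability (UN N) ≤
      ENNReal.ofReal (Real.exp ((N : ℝ) ^ 2 * (C₁ - η / 4 * L)) * Real.sqrt ψ * (κ * t) ^ P) := by
    refine lintegral_haar_le_of_classFunction (measurable_fibre t) (fibre_conj t) fun τ => ?_
    obtain ⟨d, hd, -⟩ := exists_diagonalTorus_eq_diagonal τ
    set a : ℝ := Real.exp ((N : ℝ) ^ 2 * (C₁ - η / 4 * L)) *
      ∏ j : Fin N, ∏ k ∈ Finset.Ioi j, pairFactor (κ * t) (‖d j - d k‖ ^ 2) with ha
    have hprod0 : 0 ≤ ∏ j : Fin N, ∏ k ∈ Finset.Ioi j, pairFactor (κ * t) (‖d j - d k‖ ^ 2) :=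
      Finset.prod_nonneg fun j _ => Finset.prod_nonneg fun k _ => pairFactor_nonneg hκt _
    have ha0 : 0 ≤ a := mul_nonneg (Real.exp_pos _).le hprod0
    have hA : haarProbability (UN N) {W' : UN N | ekAction ((![(τ : UN N), W'] : EKConfig 2 N)) ≤ t} ≤ ENNReal.ofReal a :=
      h₁ N hN₁ t ht ht1 (τ : UN N) d hd
    -- fibre ≤ min(a², ψ) ≤ a √ψ
    have hF : ekHaar 2 N {W : EKConfig 2 N | (Fin.cons (τ : UN N) W : EKConfig 3 N) ∈ {U : EKConfig 3 N | ekAction U ≤ t}} ≤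
        ENNReal.ofReal ((Real.exp ((N : ℝ) ^ 2 * (C₁ - η / 4 * L)) * Real.sqrt ψ) *
          ∏ j : Fin N, ∏ k ∈ Finset.Ioi j, pairFactor (κ * t) (‖d j - d k‖ ^ 2)) := by
      refine (fibre_le_min (τ : UN N) t).trans ?_
      have hsq : haarProbability (UN N) {W' : UN N | ekAction ((![(τ : UN N), W'] : EKConfig 2 N)) ≤ t} ^ 2 ≤
          ENNReal.ofReal (a ^ 2) := by
        rw [sq, sq, ENNReal.ofReal_mul ha0]
        exact mul_le_mul hA hA bot_le bot_le
      refine (min_le_min hsq hΨ).trans ?_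
      rw [← ENNReal.ofReal_min]
      refine ENNReal.ofReal_le_ofReal ((min_sq_le_mul_sqrt ha0 hψ0).trans (le_of_eq ?_))
      rw [ha]; ring
    exact weylWeight_mul_le_of_pairwise hd (mul_nonneg (Real.exp_pos _).le (Real.sqrt_nonneg _))
      (fun j k => pairFactor_nonneg hκt _) hF fun j k _ => mul_pairFactor_le hκt _
  refine hmain.trans (ENNReal.ofReal_le_ofReal ?_)
  -- logarithmic bookkeeping
  have hψpos : 0 < ψ := mul_pos (Real.exp_pos _) (pow_pos ht _)
  have hlhs_pos : 0 < Real.exp ((N : ℝ) ^ 2 * (C₁ - η / 4 * L)) * Real.sqrt ψ * (κ * t) ^ P :=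
    mul_pos (mul_pos (Real.exp_pos _) (Real.sqrt_pos.2 hψpos)) (pow_pos (mul_pos (lt_of_lt_of_le zero_lt_one hκ) ht) _)
  rw [← Real.exp_log hlhs_pos]
  refine Real.exp_le_exp.2 ?_
  have hlogψ : Real.log ψ = (N : ℝ) ^ 2 * (C₂ - η / 4 * L) + (P : ℝ) * L := by
    rw [hψ, Real.log_mul (Real.exp_pos _).ne' (pow_pos ht _).ne', Real.log_exp, Real.log_pow]
  rw [Real.log_mul (mul_pos (Real.exp_pos _) (Real.sqrt_pos.2 hψpos)).ne'
      (pow_pos (mul_pos (lt_of_lt_of_le zero_lt_one hκ) ht) _).ne',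
    Real.log_mul (Real.exp_pos _).ne' (Real.sqrt_pos.2 hψpos).ne', Real.log_exp, Real.log_sqrt hψ0, hlogψ,
    Real.log_pow, Real.log_mul (lt_of_lt_of_le zero_lt_one hκ).ne' ht.ne']
  exact exponent_bookkeeping hη hκ hL0 hN₃

end Summit.QuantumFields.YangMills.Theorems.EguchiKawaiDirectionLadder

end
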